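import Literature.Computability.Cryptography.WordRAMPatternTables
import Mathlib.Algebra.BigOperators.Intervals
import HarnessLib

/-!
# The word RAM — parsing the listed sets of a family into a membership table of bit masks

The parsing step of the verified algorithm for
`Literature.Computability.AlgebraicComplexity.pratt2024_thm_1_9` (K. Pratt, STOC 2024, Thm. 1.9;
fourteenth instalment): a family of `n₀`-element sets is listed in the input as consecutive records
`card, e₁, …, e_{n₀}` (the tree's `TripartitioningInstance.wordEncode`, after `SProg.relocate`);
for every listed set the program forms the mask `PM + ∑_t 2^{e_t}` (`PM` = the mask of the padding
elements added to this family, Pratt §2: "`𝓕_i := {X ∪ S_i : X ∈ 𝓕_{i0}}`") and sets the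
corresponding cell of a direct-addressed membership table to `1` — the table that the fill step
(`WordRAMPrattFill`) reads.

* `setMask m ep n₀ PM t = PM + ∑_{t'<t} 2^{m (ep + t')}` and `SProg.maskLoop` (`maskLoop_spec`);
* `SProg.parseFam RA RL RFT RPM` — for the family whose first card word address, length, table base
  and pad mask sit in the registers `RA, RL, RFT, RPM`: `parseFam_spec` — afterwards cell
  `FT + a` (`a < MB`) holds `1` if `a` is the mask of some listed set and its old value otherwise,
  within `len (7 n₀ + 11) + 3` steps, nothing else touched outside the temporaries `82–91` and the
  table.

## References

* K. Pratt, *A stronger connection between the asymptotic rank conjecture and the set cover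
  conjecture*, STOC 2024, arXiv:2311.02774, Problem 1.3, §2 (proof of Thm. 1.9).
* T. Nipkow, G. Klein, *Concrete Semantics with Isabelle/HOL*, Springer 2014, §12.2.
-/

namespace Literature.Computability.Cryptography.WordRAM

open StateTransition Finset

open scoped BigOperators

/-- The mask of the first `t` listed elements at `ep`, on top of the pad mask `PM`. [cite: Pratt2024SCC, §2 (proof of Thm. 1.9)] -/
def setMask (m : ℕ → ℕ) (ep PM t : ℕ) : ℕ := PM + ∑ t' ∈ range t, 2 ^ m (ep + t')

/-- No elements: the pad mask. [folklore] -/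
@[simp] theorem setMask_zero (m : ℕ → ℕ) (ep PM : ℕ) : setMask m ep PM 0 = PM := by simp [setMask]

/-- One more element. [folklore] -/
theorem setMask_succ (m : ℕ → ℕ) (ep PM t : ℕ) :
    setMask m ep PM (t + 1) = setMask m ep PM t + 2 ^ m (ep + t) := by
  simp [setMask, sum_range_succ, Nat.add_assoc]

/-- Masks grow. [folklore] -/
theorem setMask_mono (m : ℕ → ℕ) (ep PM : ℕ) {t u : ℕ} (h : t ≤ u) : setMask m ep PM t ≤ setMask m ep PM u := by
  unfold setMask
  exact Nat.add_le_add_left (sum_le_sum_of_subset (range_subset_range.2 h)) _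

namespace SProg

variable {w : ℕ} {O : List ℕ → List ℕ}

/-! ## The mask of one set -/

/-- Body: `e := mem[ep]; pw := 1 shl e; mask += pw; ep++; cnt--` (registers `83` pointer, `84` count,
`85` mask, scratch `86, 87`). [folklore] -/
def maskBody : List OpSpec :=
  [(.add, .dir 86, .ind 83, .imm 0), (.shl, .dir 87, .imm 1, .dir 86), (.add, .dir 85, .dir 85, .dir 87),
    (.add, .dir 83, .dir 83, .imm 1), (.sub, .dir 84, .dir 84, .imm 1)]

/-- The mask loop. [folklore] -/
def maskLoop : SProg := whilenz (.dir 84) (block maskBody)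

/-- Invariant of the mask loop after `t` elements. [folklore] -/
structure MaskInv (m : ℕ → ℕ) (ep n₀ PM : ℕ) (qs : List (List ℕ)) (t : ℕ) (st : Store) : Prop where
  queries : st.queries = qs
  r83 : st.mem 83 = ep + t
  r84 : st.mem 84 = n₀ - t
  r85 : st.mem 85 = setMask m ep PM t
  frame : ∀ c, ¬ (83 ≤ c ∧ c ≤ 87) → st.mem c = m c

set_option linter.unusedSimpArgs false in
/-- One element. [folklore] -/
theorem maskBody_spec {m : ℕ → ℕ} {ep n₀ PM MB : ℕ} {qs : List (List ℕ)} {t : ℕ} (ht : t < n₀)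
    (hep : 100 ≤ ep) (hepE : ep + n₀ < 2 ^ w) (hel : ∀ t, t < n₀ → m (ep + t) < w)
    (hmask : setMask m ep PM n₀ < MB) (hMB : MB ≤ 2 ^ w) {st : Store} (h : MaskInv m ep n₀ PM qs t st) :
    ∃ st', Exec w O (block maskBody) st st' 5 ∧ MaskInv m ep n₀ PM qs (t + 1) st' := by
  obtain ⟨hq, h83, h84, h85, hfr⟩ := h
  obtain ⟨mm, qq⟩ := st
  simp only at hq h83 h84 h85 hfr
  subst qq
  have hev : mm (ep + t) = m (ep + t) := hfr _ (by omega)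
  have helt : m (ep + t) < w := hel t ht
  have hew : m (ep + t) < 2 ^ w := lt_trans helt Nat.lt_two_pow_self
  have hpow : 2 ^ m (ep + t) < 2 ^ w := Nat.pow_lt_pow_right (by norm_num) helt
  have hshl : 1 * 2 ^ m (ep + t) < 2 ^ w := by omega
  have hle : setMask m ep PM t + 2 ^ m (ep + t) ≤ setMask m ep PM n₀ := by
    rw [← setMask_succ]; exact setMask_mono m ep PM (by omega)
  refine Exec.block_of_fwd maskBody qs fun Rf hR => ?_
  unfold maskBody at hR
  have htmp := execOps_cons_fwd hR; clear hR; obtain ⟨v1, hv1, hR⟩ := htmp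
  simp -failIfUnchanged (disch := omega) only [Operand.write, Operand.read,
    Function.update_self, Function.update_of_ne, BinOp.eval_add_mod', BinOp.eval_mul_mod',
    Nat.mod_eq_of_lt, BinOp.eval_sub_of_le, Nat.add_zero, h83, hev] at hv1 hR
  subst v1
  have htmp := execOps_cons_fwd hR; clear hR; obtain ⟨v2, hv2, hR⟩ := htmp
  simp -failIfUnchanged (disch := omega) only [Operand.write, Operand.read,
    Function.update_self, Function.update_of_ne, BinOp.eval_shl_of_lt hshl, Nat.one_mul,
    Nat.add_zero] at hv2 hR
  subst v2
  have htmp := execOps_cons_fwd hR; clear hR; obtain ⟨v3, hv3, hR⟩ := htmp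
  simp -failIfUnchanged (disch := omega) only [Operand.write, Operand.read,
    Function.update_self, Function.update_of_ne, BinOp.eval_add_mod', BinOp.eval_mul_mod',
    Nat.mod_eq_of_lt, BinOp.eval_sub_of_le, Nat.add_zero, h85] at hv3 hR
  subst v3
  have htmp := execOps_cons_fwd hR; clear hR; obtain ⟨v4, hv4, hR⟩ := htmp
  simp -failIfUnchanged (disch := omega) only [Operand.write, Operand.read,
    Function.update_self, Function.update_of_ne, BinOp.eval_add_mod', BinOp.eval_mul_mod',
    Nat.mod_eq_of_lt, BinOp.eval_sub_of_le, Nat.add_zero, h83] at hv4 hR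
  subst v4
  have htmp := execOps_cons_fwd hR; clear hR; obtain ⟨v5, hv5, hR⟩ := htmp
  simp -failIfUnchanged (disch := omega) only [Operand.write, Operand.read,
    Function.update_self, Function.update_of_ne, BinOp.eval_add_mod', BinOp.eval_mul_mod',
    Nat.mod_eq_of_lt, BinOp.eval_sub_of_le, Nat.add_zero, h84] at hv5 hR
  subst v5
  simp only [execOps_nil] at hR
  subst hR
  refine ⟨rfl, ?_, ?_, ?_, fun c hc => ?_⟩ <;> dsimp only
  · simp (disch := omega) only [Function.update_of_ne, Function.update_self]; omega
  · simp (disch := omega) only [Function.update_of_ne, Function.update_self]; omega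
  · simp (disch := omega) only [Function.update_of_ne, Function.update_self]; rw [setMask_succ]
  · simp (disch := omega) only [Function.update_of_ne, Function.update_self]; exact hfr c hc

/-- The mask loop: within `7 n₀ + 1` steps register `85` holds `setMask m ep PM n₀`. [folklore] -/
theorem maskLoop_spec {m : ℕ → ℕ} {ep n₀ PM MB : ℕ} {qs : List (List ℕ)}
    (hep : 100 ≤ ep) (hepE : ep + n₀ < 2 ^ w) (hel : ∀ t, t < n₀ → m (ep + t) < w)
    (hmask : setMask m ep PM n₀ < MB) (hMB : MB ≤ 2 ^ w) {st : Store} (h : MaskInv m ep n₀ PM qs 0 st) :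
    ∃ st', ExecLE w O maskLoop st st' (n₀ * 7 + 1) ∧ MaskInv m ep n₀ PM qs n₀ st' :=
  ExecLE.whilenz_invariant (w := w) (O := O) (x := .dir 84) (s := block maskBody) n₀ 5
    (fun t st => MaskInv m ep n₀ PM qs t st)
    (fun t ht st hst => ⟨by rw [Operand.read_dir, hst.r84]; omega,
      by obtain ⟨st', hex, hinv⟩ := maskBody_spec (w := w) (O := O) ht hep hepE hel hmask hMB hst
         exact ⟨st', hex.execLE, hinv⟩⟩)
    (fun st hst => by rw [Operand.read_dir, hst.r84]; omega) h

/-! ## One family -/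

/-- `setptr := reg RA; cnt := reg RL`. [folklore] -/
def famSetup (RA RL : ℕ) : List OpSpec :=
  [(.add, .dir 91, .dir RA, .imm 0), (.add, .dir 82, .dir RL, .imm 0)]

/-- Before the mask loop: `ep := setptr + 1; cnt := n₀; mask := reg RPM`. [folklore] -/
def setPre (RPM : ℕ) : List OpSpec :=
  [(.add, .dir 83, .dir 91, .imm 1), (.add, .dir 84, .dir 3, .imm 0), (.add, .dir 85, .dir RPM, .imm 0)]

/-- After the mask loop: `addr := reg RFT + mask; mem[addr] := 1; setptr += s; cnt -= 1`. [folklore] -/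
def setPost (RFT : ℕ) : List OpSpec :=
  [(.add, .dir 88, .dir RFT, .dir 85), (.add, .ind 88, .imm 1, .imm 0),
    (.add, .dir 91, .dir 91, .dir 73), (.sub, .dir 82, .dir 82, .imm 1)]

/-- One listed set: form its mask and mark it in the table. [folklore] -/
def setBody (RFT RPM : ℕ) : SProg := seq (block (setPre RPM)) (seq maskLoop (block (setPost RFT)))

/-- **Parse one family**: registers `RA` = address of its first card word, `RL` = its length,
`RFT` = its table base, `RPM` = its pad mask. [cite: Pratt2024SCC, §2 (proof of Thm. 1.9)] -/
def parseFam (RA RL RFT RPM : ℕ) : SProg := seq (block (famSetup RA RL)) (whilenz (.dir 82) (setBody RFT RPM))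

/-- The data of one family: first card word at `A`, `len` sets of stride `s` with `n₀` elements each,
table base `FT` of size `MB`, pad mask `PM`. [folklore] -/
structure FamLayout where
  /-- Address of the first card word. -/
  A : ℕ
  /-- Number of listed sets. -/
  len : ℕ
  /-- Words per listed set. -/
  s : ℕ
  /-- Elements per set. -/
  n₀ : ℕ
  /-- Base of the membership table. -/
  FT : ℕ
  /-- Size of the membership table. -/
  MB : ℕ
  /-- Mask of the padding elements of this family. -/
  PM : ℕ

/-- The mask of the `j`-th listed set (with the pad mask). [cite: Pratt2024SCC, §2 (proof of Thm. 1.9)] -/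
def FamLayout.code (F : FamLayout) (m : ℕ → ℕ) (j : ℕ) : ℕ := setMask m (F.A + j * F.s + 1) F.PM F.n₀

/-- Static side conditions of parsing one family. [folklore] -/
structure FamSide (w : ℕ) (m : ℕ → ℕ) (F : FamLayout) : Prop where
  hA : 100 ≤ F.A
  hAE : F.A + F.len * F.s < 2 ^ w
  hs : F.n₀ + 1 ≤ F.s
  hFT : 100 ≤ F.FT
  hFTE : F.FT + F.MB ≤ 2 ^ w
  hlen : F.len < 2 ^ w
  hdisj : F.A + F.len * F.s ≤ F.FT ∨ F.FT + F.MB ≤ F.A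
  hel : ∀ j t, j < F.len → t < F.n₀ → m (F.A + j * F.s + 1 + t) < w
  hcode : ∀ j, j < F.len → F.code m j < F.MB

/-- Invariant of the family loop after `j` sets. [folklore] -/
structure SetInv (m : ℕ → ℕ) (F : FamLayout) (qs : List (List ℕ)) (j : ℕ) (st : Store) : Prop where
  queries : st.queries = qs
  r82 : st.mem 82 = F.len - j
  r91 : st.mem 91 = F.A + j * F.s
  table : ∀ a, a < F.MB → st.mem (F.FT + a) = if ∃ j', j' < j ∧ a = F.code m j' then 1 else m (F.FT + a)
  frame : ∀ c, ¬ (82 ≤ c ∧ c ≤ 88) → c ≠ 91 → ¬ (F.FT ≤ c ∧ c < F.FT + F.MB) → st.mem c = m c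

set_option linter.unusedSimpArgs false in
/-- **One listed set.** [folklore] -/
theorem setBody_spec {m : ℕ → ℕ} {F : FamLayout} {qs : List (List ℕ)} {j RFT RPM : ℕ} (hj : j < F.len)
    (hS : FamSide w m F) (hRFT : RFT < 82) (hRPM : RPM < 82) (h3 : m 3 = F.n₀) (h73 : m 73 = F.s)
    (hft : m RFT = F.FT) (hpm : m RPM = F.PM) {st : Store} (h : SetInv m F qs j st) :
    ∃ st', ExecLE w O (setBody RFT RPM) st st' (F.n₀ * 7 + 10) ∧ SetInv m F qs (j + 1) st' := by
  obtain ⟨hA, hAE, hs, hFT, hFTE, hlen, hdisj, hel, hcode⟩ := hS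
  obtain ⟨hq, h82, h91, htab, hfr⟩ := h
  obtain ⟨mm, qq⟩ := st
  simp only at hq h82 h91 htab hfr
  subst qq
  have hjs : j * F.s + F.s ≤ F.len * F.s := by
    have := Nat.mul_le_mul_right F.s hj; rw [Nat.succ_mul] at this; exact this
  have hcj := hcode j hj
  have hPMle : F.PM ≤ F.code m j := by
    have := setMask_mono m (F.A + j * F.s + 1) F.PM (Nat.zero_le F.n₀)
    rwa [setMask_zero] at this
  have hPMw : F.PM < 2 ^ w := by omega
  have e3 : mm 3 = F.n₀ := by rw [hfr 3 (by omega) (by omega) (by omega)]; exact h3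
  have epm : mm RPM = F.PM := by rw [hfr RPM (by omega) (by omega) (by omega)]; exact hpm
  -- pre
  have hev₁ : execOps w mm (setPre RPM) = Function.update (Function.update (Function.update mm 83
      (F.A + j * F.s + 1)) 84 F.n₀) 85 F.PM := by
    unfold setPre
    simp -failIfUnchanged (disch := omega) only [execOps_cons, execOps_nil, execOp, Operand.write,
      Operand.read, Function.update_self, Function.update_of_ne, BinOp.eval_add_mod',
      Nat.mod_eq_of_lt, Nat.add_zero, h91, e3, epm]
  have hex₁ : Exec w O (block (setPre RPM)) ⟨mm, qs⟩ ⟨execOps w mm (setPre RPM), qs⟩ 3 :=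
    Exec.block' (setPre RPM) qs rfl
  rw [hev₁] at hex₁
  set mm₁ := Function.update (Function.update (Function.update mm 83 (F.A + j * F.s + 1)) 84 F.n₀) 85 F.PM
    with hmm₁
  have hagree₁ : ∀ c, ¬ (83 ≤ c ∧ c ≤ 85) → mm₁ c = mm c := fun c hc => by
    rw [hmm₁]; simp (disch := omega) only [Function.update_of_ne, Function.update_self]
  have hel₁ : ∀ t, t < F.n₀ → mm₁ (F.A + j * F.s + 1 + t) = m (F.A + j * F.s + 1 + t) := fun t ht => by
    rw [hagree₁ _ (by omega)]
    exact hfr _ (by omega) (by omega) (by rcases hdisj with hh | hh <;> omega)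
  have hmask₁ : setMask mm₁ (F.A + j * F.s + 1) F.PM F.n₀ = F.code m j := by
    unfold FamLayout.code setMask
    congr 1
    exact sum_congr rfl fun t ht => by rw [mem_range] at ht; rw [hel₁ t ht]
  have hM : MaskInv mm₁ (F.A + j * F.s + 1) F.n₀ F.PM qs 0 ⟨mm₁, qs⟩ := by
    refine ⟨rfl, ?_, ?_, ?_, fun c _ => rfl⟩ <;> dsimp only <;> rw [hmm₁]
    · simp (disch := omega) only [Function.update_of_ne, Function.update_self]; try omega
    · simp (disch := omega) only [Function.update_of_ne, Function.update_self]; try omega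
    · simp (disch := omega) only [Function.update_of_ne, Function.update_self]; try simp
  obtain ⟨st₂, hex₂, hM₂⟩ := maskLoop_spec (w := w) (O := O) (MB := F.MB) (by omega) (by omega)
    (fun t ht => by rw [hel₁ t ht]; exact hel j t hj ht) (by rw [hmask₁]; exact hcj) (by omega) hM
  obtain ⟨hq₂, k83, k84, k85, kfr⟩ := hM₂
  rw [hmask₁] at k85
  obtain ⟨mm₂, qq₂⟩ := st₂
  simp only at hq₂ k83 k84 k85 kfr
  subst qq₂
  have hagree₂ : ∀ c, ¬ (83 ≤ c ∧ c ≤ 87) → mm₂ c = mm c := fun c hc => by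
    rw [kfr c hc]; exact hagree₁ c (by omega)
  have f91 : mm₂ 91 = F.A + j * F.s := by rw [hagree₂ 91 (by omega)]; exact h91
  have f82 : mm₂ 82 = F.len - j := by rw [hagree₂ 82 (by omega)]; exact h82
  have f73 : mm₂ 73 = F.s := by rw [hagree₂ 73 (by omega), hfr 73 (by omega) (by omega) (by omega)]; exact h73
  have fft : mm₂ RFT = F.FT := by
    rw [hagree₂ RFT (by omega), hfr RFT (by omega) (by omega) (by omega)]; exact hft
  -- post
  have hev₃ : execOps w mm₂ (setPost RFT) = Function.update (Function.update (Function.update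
      (Function.update mm₂ 88 (F.FT + F.code m j)) (F.FT + F.code m j) 1) 91 (F.A + j * F.s + F.s))
      82 (F.len - j - 1) := by
    unfold setPost
    simp -failIfUnchanged (disch := omega) only [execOps_cons, execOps_nil, execOp, Operand.write,
      Operand.read, Function.update_self, Function.update_of_ne, BinOp.eval_add_mod',
      Nat.mod_eq_of_lt, BinOp.eval_sub_of_le, Nat.add_zero, k85, fft, f91, f73, f82]
  have hex₃ : Exec w O (block (setPost RFT)) ⟨mm₂, qs⟩ ⟨execOps w mm₂ (setPost RFT), qs⟩ 4 :=
    Exec.block' (setPost RFT) qs rfl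
  rw [hev₃] at hex₃
  refine ⟨_, ((hex₁.execLE).seq (hex₂.seq hex₃.execLE)).mono (by omega), ?_⟩
  refine ⟨rfl, ?_, ?_, fun a ha => ?_, fun c hc hc91 hnc => ?_⟩ <;> dsimp only
  · simp (disch := omega) only [Function.update_of_ne, Function.update_self]; omega
  · simp (disch := omega) only [Function.update_of_ne, Function.update_self]; rw [Nat.succ_mul, Nat.add_assoc]
  · by_cases haj : a = F.code m j
    · subst haj
      simp (disch := omega) only [Function.update_of_ne, Function.update_self]
      rw [if_pos ⟨j, Nat.lt_succ_self j, rfl⟩]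
    · rw [Function.update_of_ne (show F.FT + a ≠ 82 by omega),
        Function.update_of_ne (show F.FT + a ≠ 91 by omega),
        Function.update_of_ne (show F.FT + a ≠ F.FT + F.code m j by omega),
        Function.update_of_ne (show F.FT + a ≠ 88 by omega), hagree₂ _ (by omega), htab a ha]
      congr 1
      refine propext ⟨?_, ?_⟩
      · rintro ⟨j', hj', rfl⟩; exact ⟨j', by omega, rfl⟩
      · rintro ⟨j', hj', hjc⟩
        rcases Nat.lt_succ_iff_lt_or_eq.1 hj' with hlt | rfl
        · exact ⟨j', hlt, hjc⟩
        · exact absurd hjc haj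
  · simp (disch := omega) only [Function.update_of_ne, Function.update_self]
    rw [hagree₂ c (by omega)]; exact hfr c hc hc91 hnc

/-- Register data of `parseFam`. [folklore] -/
structure FamRegs (m : ℕ → ℕ) (F : FamLayout) (RA RL RFT RPM : ℕ) : Prop where
  hRA : RA < 82
  hRL : RL < 82
  hRFT : RFT < 82
  hRPM : RPM < 82
  r3 : m 3 = F.n₀
  r73 : m 73 = F.s
  ra : m RA = F.A
  rl : m RL = F.len
  rft : m RFT = F.FT
  rpm : m RPM = F.PM

set_option linter.unusedSimpArgs false in
/-- **Parsing one family into its membership table.** With the layout `F` (side conditions `FamSide`)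
and its registers (`FamRegs`), `parseFam RA RL RFT RPM` ends within `len (7 n₀ + 12) + 3` steps in a
memory in which, for every `a < MB`, cell `FT + a` holds `1` if `a` is the mask (pad mask plus the
bits of the listed elements) of some listed set of the family, and its old value otherwise; nothing
else changed outside `82–88`, `91` and the table. [cite: Pratt2024SCC, §2 (proof of Thm. 1.9)] -/
theorem parseFam_spec {m : ℕ → ℕ} {F : FamLayout} {RA RL RFT RPM : ℕ} (hS : FamSide w m F)
    (hR : FamRegs m F RA RL RFT RPM) (qs : List (List ℕ)) :
    ∃ st', ExecLE w O (parseFam RA RL RFT RPM) ⟨m, qs⟩ st' (F.len * (F.n₀ * 7 + 12) + 3) ∧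
      SetInv m F qs F.len st' := by
  obtain ⟨hRA, hRL, hRFT, hRPM, r3, r73, ra, rl, rft, rpm⟩ := hR
  have hA := hS.hA; have hAE := hS.hAE; have hlen := hS.hlen
  have hev₁ : execOps w m (famSetup RA RL) = Function.update (Function.update m 91 F.A) 82 F.len := by
    unfold famSetup
    simp -failIfUnchanged (disch := omega) only [execOps_cons, execOps_nil, execOp, Operand.write,
      Operand.read, Function.update_self, Function.update_of_ne, BinOp.eval_add_mod',
      Nat.mod_eq_of_lt, Nat.add_zero, ra, rl]
  have hex₁ : Exec w O (block (famSetup RA RL)) ⟨m, qs⟩ ⟨execOps w m (famSetup RA RL), qs⟩ 2 :=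
    Exec.block' (famSetup RA RL) qs rfl
  rw [hev₁] at hex₁
  have h0 : SetInv m F qs 0 ⟨Function.update (Function.update m 91 F.A) 82 F.len, qs⟩ := by
    refine ⟨rfl, ?_, ?_, fun a ha => ?_, fun c hc hc91 _ => ?_⟩ <;> dsimp only
    · simp (disch := omega) only [Function.update_of_ne, Function.update_self]; omega
    · simp (disch := omega) only [Function.update_of_ne, Function.update_self]; omega
    · have hFT := hS.hFT
      simp (disch := omega) only [Function.update_of_ne, Function.update_self]
      rw [if_neg (by rintro ⟨j', hj', _⟩; exact Nat.not_lt_zero _ hj')]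
    · simp (disch := omega) only [Function.update_of_ne, Function.update_self]
  obtain ⟨st', hex, hinv⟩ := ExecLE.whilenz_invariant (w := w) (O := O) (x := .dir 82) (s := setBody RFT RPM)
    F.len (F.n₀ * 7 + 10) (fun j st => SetInv m F qs j st)
    (fun j hj st hst => ⟨by rw [Operand.read_dir, hst.r82]; omega,
      setBody_spec hj hS hRFT hRPM r3 r73 rft rpm hst⟩)
    (fun st hst => by rw [Operand.read_dir, hst.r82]; omega) h0
  rw [show F.n₀ * 7 + 10 + 2 = F.n₀ * 7 + 12 by omega] at hex
  exact ⟨st', (ExecLE.seq hex₁.execLE hex).mono (by omega), hinv⟩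

/-! ## The header: `n₀`, the stride, the three families' addresses and lengths, the input length -/

/-- Read the header of a relocated instance (cell `0` = `D + 1`, cell `1` = `D`, input word `x[p]` in
cell `D + 1 + p`): `n₀ := x[0]; s := n₀ + 1; A₀ := D + 3; len₀ := x[1]; A₁ := A₀ + len₀ s + 1;
len₁ := mem[A₁ - 1]; A₂ := A₁ + len₁ s + 1; len₂ := mem[A₂ - 1]; L := D - 100`. [folklore] -/
def headerBlock : List OpSpec :=
  [(.add, .dir 3, .ind 0, .imm 0), (.add, .dir 73, .dir 3, .imm 1), (.add, .dir 74, .dir 0, .imm 2),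
    (.add, .dir 88, .dir 0, .imm 1), (.add, .dir 77, .ind 88, .imm 0), (.mul, .dir 88, .dir 77, .dir 73),
    (.add, .dir 88, .dir 74, .dir 88), (.add, .dir 78, .ind 88, .imm 0), (.add, .dir 75, .dir 88, .imm 1),
    (.mul, .dir 88, .dir 78, .dir 73), (.add, .dir 88, .dir 75, .dir 88), (.add, .dir 79, .ind 88, .imm 0),
    (.add, .dir 76, .dir 88, .imm 1), (.sub, .dir 4, .dir 1, .imm 100)]

/-- The header data of a relocated instance. [folklore] -/
structure Header where
  /-- `D = L + 100`. -/
  D : ℕ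
  /-- Elements per set. -/
  n₀ : ℕ
  /-- Lengths of the three families. -/
  len : ℕ → ℕ

/-- Words per listed set. [folklore] -/
def Header.s (H : Header) : ℕ := H.n₀ + 1

/-- Address of the first card word of family `i`. [folklore] -/
def Header.A (H : Header) : ℕ → ℕ
  | 0 => H.D + 3
  | 1 => H.D + 3 + H.len 0 * H.s + 1
  | _ => H.D + 3 + H.len 0 * H.s + 1 + H.len 1 * H.s + 1

/-- What the memory must hold for `headerBlock`: the pointers of `relocate`, and the header words at
their places (as in `TripartitioningInstance.wordEncode`). [folklore] -/
structure HeaderMem (w : ℕ) (m : ℕ → ℕ) (H : Header) : Prop where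
  h0 : m 0 = H.D + 1
  h1 : m 1 = H.D
  hD : 100 ≤ H.D
  hn : m (H.D + 1) = H.n₀
  hl0 : m (H.D + 2) = H.len 0
  hl1 : m (H.A 1 - 1) = H.len 1
  hl2 : m (H.A 2 - 1) = H.len 2
  hfit : H.A 2 + H.len 2 * H.s < 2 ^ w
  hsw : H.s < 2 ^ w

set_option linter.unusedSimpArgs false in
/-- **The header block.** [folklore] -/
theorem headerBlock_spec {m : ℕ → ℕ} {H : Header} (hM : HeaderMem w m H) (qs : List (List ℕ)) :
    ∃ st', Exec w O (block headerBlock) ⟨m, qs⟩ st' 14 ∧ st'.queries = qs ∧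
      st'.mem 3 = H.n₀ ∧ st'.mem 73 = H.s ∧ st'.mem 74 = H.A 0 ∧ st'.mem 75 = H.A 1 ∧
      st'.mem 76 = H.A 2 ∧ st'.mem 77 = H.len 0 ∧ st'.mem 78 = H.len 1 ∧ st'.mem 79 = H.len 2 ∧
      st'.mem 4 = H.D - 100 ∧
      (∀ c, c ≠ 3 → c ≠ 4 → ¬ (73 ≤ c ∧ c ≤ 79) → c ≠ 88 → st'.mem c = m c) := by
  obtain ⟨h0, h1, hD, hn, hl0, hl1, hl2, hfit, hsw⟩ := hM
  have hA0 : H.A 0 = H.D + 3 := rfl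
  have hA1 : H.A 1 = H.D + 3 + H.len 0 * H.s + 1 := rfl
  have hA2 : H.A 2 = H.D + 3 + H.len 0 * H.s + 1 + H.len 1 * H.s + 1 := rfl
  have hs' : H.n₀ + 1 = H.s := rfl
  rw [hA1] at hl1; rw [hA2] at hl2 hfit
  simp only [Nat.add_sub_cancel] at hl1 hl2
  have hl1' : m (H.D + 1 + 2 + H.len 0 * H.s) = H.len 1 := by
    rw [show H.D + 1 + 2 = H.D + 3 by omega]; exact hl1
  have hl2' : m (H.D + 1 + 2 + H.len 0 * H.s + 1 + H.len 1 * H.s) = H.len 2 := by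
    rw [show H.D + 1 + 2 = H.D + 3 by omega]; exact hl2
  have hb1 : H.len 0 * H.s + H.len 1 * H.s + H.len 2 * H.s + H.D + 5 < 2 ^ w := by omega
  have hspos : 0 < H.s := by rw [← hs']; omega
  have hl0s : H.len 0 ≤ H.len 0 * H.s := Nat.le_mul_of_pos_right _ hspos
  have hl1s : H.len 1 ≤ H.len 1 * H.s := Nat.le_mul_of_pos_right _ hspos
  have hl2s : H.len 2 ≤ H.len 2 * H.s := Nat.le_mul_of_pos_right _ hspos
  have hn₀ : H.n₀ < 2 ^ w := by rw [← hs'] at hsw; omega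
  refine Exec.block_of_fwd headerBlock qs fun Rf hR => ?_
  unfold headerBlock at hR
  have htmp := execOps_cons_fwd hR; clear hR; obtain ⟨v1, hv1, hR⟩ := htmp
  simp -failIfUnchanged (disch := omega) only [Operand.write, Operand.read,
    Function.update_self, Function.update_of_ne, BinOp.eval_add_mod', BinOp.eval_mul_mod',
    Nat.mod_eq_of_lt, BinOp.eval_sub_of_le, Nat.add_zero, h0, hn] at hv1 hR
  subst v1
  have htmp := execOps_cons_fwd hR; clear hR; obtain ⟨v2, hv2, hR⟩ := htmp
  simp -failIfUnchanged (disch := omega) only [Operand.write, Operand.read,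
    Function.update_self, Function.update_of_ne, BinOp.eval_add_mod', BinOp.eval_mul_mod',
    Nat.mod_eq_of_lt, BinOp.eval_sub_of_le, Nat.add_zero, hs'] at hv2 hR
  subst v2
  have htmp := execOps_cons_fwd hR; clear hR; obtain ⟨v3, hv3, hR⟩ := htmp
  simp -failIfUnchanged (disch := omega) only [Operand.write, Operand.read,
    Function.update_self, Function.update_of_ne, BinOp.eval_add_mod', BinOp.eval_mul_mod',
    Nat.mod_eq_of_lt, BinOp.eval_sub_of_le, Nat.add_zero, h0] at hv3 hR
  subst v3
  have htmp := execOps_cons_fwd hR; clear hR; obtain ⟨v4, hv4, hR⟩ := htmp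
  simp -failIfUnchanged (disch := omega) only [Operand.write, Operand.read,
    Function.update_self, Function.update_of_ne, BinOp.eval_add_mod', BinOp.eval_mul_mod',
    Nat.mod_eq_of_lt, BinOp.eval_sub_of_le, Nat.add_zero, h0] at hv4 hR
  subst v4
  have htmp := execOps_cons_fwd hR; clear hR; obtain ⟨v5, hv5, hR⟩ := htmp
  simp -failIfUnchanged (disch := omega) only [Operand.write, Operand.read,
    Function.update_self, Function.update_of_ne, BinOp.eval_add_mod', BinOp.eval_mul_mod',
    Nat.mod_eq_of_lt, BinOp.eval_sub_of_le, Nat.add_zero, hl0] at hv5 hR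
  subst v5
  have htmp := execOps_cons_fwd hR; clear hR; obtain ⟨v6, hv6, hR⟩ := htmp
  simp -failIfUnchanged (disch := omega) only [Operand.write, Operand.read,
    Function.update_self, Function.update_of_ne, BinOp.eval_add_mod', BinOp.eval_mul_mod',
    Nat.mod_eq_of_lt, BinOp.eval_sub_of_le, Nat.add_zero] at hv6 hR
  subst v6
  have htmp := execOps_cons_fwd hR; clear hR; obtain ⟨v7, hv7, hR⟩ := htmp
  simp -failIfUnchanged (disch := omega) only [Operand.write, Operand.read,
    Function.update_self, Function.update_of_ne, BinOp.eval_add_mod', BinOp.eval_mul_mod',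
    Nat.mod_eq_of_lt, BinOp.eval_sub_of_le, Nat.add_zero] at hv7 hR
  subst v7
  have htmp := execOps_cons_fwd hR; clear hR; obtain ⟨v8, hv8, hR⟩ := htmp
  simp -failIfUnchanged (disch := omega) only [Operand.write, Operand.read,
    Function.update_self, Function.update_of_ne, BinOp.eval_add_mod', BinOp.eval_mul_mod',
    Nat.mod_eq_of_lt, BinOp.eval_sub_of_le, Nat.add_zero, hl1'] at hv8 hR
  subst v8
  have htmp := execOps_cons_fwd hR; clear hR; obtain ⟨v9, hv9, hR⟩ := htmp
  simp -failIfUnchanged (disch := omega) only [Operand.write, Operand.read,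
    Function.update_self, Function.update_of_ne, BinOp.eval_add_mod', BinOp.eval_mul_mod',
    Nat.mod_eq_of_lt, BinOp.eval_sub_of_le, Nat.add_zero] at hv9 hR
  subst v9
  have htmp := execOps_cons_fwd hR; clear hR; obtain ⟨v10, hv10, hR⟩ := htmp
  simp -failIfUnchanged (disch := omega) only [Operand.write, Operand.read,
    Function.update_self, Function.update_of_ne, BinOp.eval_add_mod', BinOp.eval_mul_mod',
    Nat.mod_eq_of_lt, BinOp.eval_sub_of_le, Nat.add_zero] at hv10 hR
  subst v10
  have htmp := execOps_cons_fwd hR; clear hR; obtain ⟨v11, hv11, hR⟩ := htmp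
  simp -failIfUnchanged (disch := omega) only [Operand.write, Operand.read,
    Function.update_self, Function.update_of_ne, BinOp.eval_add_mod', BinOp.eval_mul_mod',
    Nat.mod_eq_of_lt, BinOp.eval_sub_of_le, Nat.add_zero] at hv11 hR
  subst v11
  have htmp := execOps_cons_fwd hR; clear hR; obtain ⟨v12, hv12, hR⟩ := htmp
  simp -failIfUnchanged (disch := omega) only [Operand.write, Operand.read,
    Function.update_self, Function.update_of_ne, BinOp.eval_add_mod', BinOp.eval_mul_mod',
    Nat.mod_eq_of_lt, BinOp.eval_sub_of_le, Nat.add_zero, hl2'] at hv12 hR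
  subst v12
  have htmp := execOps_cons_fwd hR; clear hR; obtain ⟨v13, hv13, hR⟩ := htmp
  simp -failIfUnchanged (disch := omega) only [Operand.write, Operand.read,
    Function.update_self, Function.update_of_ne, BinOp.eval_add_mod', BinOp.eval_mul_mod',
    Nat.mod_eq_of_lt, BinOp.eval_sub_of_le, Nat.add_zero] at hv13 hR
  subst v13
  have htmp := execOps_cons_fwd hR; clear hR; obtain ⟨v14, hv14, hR⟩ := htmp
  simp -failIfUnchanged (disch := omega) only [Operand.write, Operand.read,
    Function.update_self, Function.update_of_ne, BinOp.eval_add_mod', BinOp.eval_mul_mod',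
    Nat.mod_eq_of_lt, BinOp.eval_sub_of_le, Nat.add_zero, h1] at hv14 hR
  subst v14
  simp only [execOps_nil] at hR
  subst hR
  refine ⟨rfl, ?_, ?_, ?_, ?_, ?_, ?_, ?_, ?_, ?_, fun c h3' h4' hc h88' => ?_⟩ <;> dsimp only
  · simp (disch := omega) only [Function.update_of_ne, Function.update_self]
  · simp (disch := omega) only [Function.update_of_ne, Function.update_self]
  · simp (disch := omega) only [Function.update_of_ne, Function.update_self]; rw [hA0]
  · simp (disch := omega) only [Function.update_of_ne, Function.update_self]; rw [hA1]; try omega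
  · simp (disch := omega) only [Function.update_of_ne, Function.update_self]; rw [hA2]; try omega
  · simp (disch := omega) only [Function.update_of_ne, Function.update_self]
  · simp (disch := omega) only [Function.update_of_ne, Function.update_self]
  · simp (disch := omega) only [Function.update_of_ne, Function.update_self]
  · simp (disch := omega) only [Function.update_of_ne, Function.update_self]
  · simp (disch := omega) only [Function.update_of_ne, Function.update_self]

end SProg

end Literature.Computability.Cryptography.WordRAM
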